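import Summits.CriticalPhenomena.PercolationContinuityZ3.Theorems.Transplant.PlanarSkeletonFrmFromDefs
import Summits.CriticalPhenomena.PercolationContinuityZ3.Theorems.Transplant.SkelFrmFromBChoiceDefs
import Summits.CriticalPhenomena.PercolationContinuityZ3.Theorems.Transplant.SkelFrmBChoiceDefs
import HarnessLib
import Summits.CriticalPhenomena.PercolationContinuityZ3.Theorems.Transplant.SkelFrmBChoiceDefs3
/-!
# U-WAVE PORT (RULING D-U, lead g21 2026-08-26; WAVE-U-MANIFEST v3.0 row «SkelFrmBChoiceDefs3» ↦ «SkelFrmFromBChoiceDefs3») of the tree module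
# `Transplant/SkelFrmBChoiceDefs3` onto the carrier `PlanarSkeletonFrmFrom` (frames only, cylinders connected from width `ℓ₀` on)

ORIGINAL TITLE: N2 (the frames-only node `SamePDropOfSkeletonFrm₁`, OPEN): THE CHOICE FUNCTION OF RECORD WITH THE STEP-I‴ ACCURACY AT THE CUBE — `NegB.δI3`, `NegB.choiceAtQ3`,

builds on p205010 (kernel theorem, internal audit signed; external expert review pending) — nothing in this file uses p205010; NOTHING is claimed about the
OPEN node U `SamePDropOfSkeletonFrmFrom₁` (nor U_s / the end state).  Lane `prim-bschramm`, seat `prim-hp-8 gen 53 (U-wave port pen; tool of record = p3-g26 port_u.py)`; helper file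
(`--supports stmt-CriticalPhenomena-4575 --as helper`).  PORT RULES r1–r4 of RULING D-U: declaration order and proof texts are those of the original,
byte-identical except (i) the carrier token `PlanarSkeletonFrm ↦ PlanarSkeletonFrmFrom` (binders, `namespace`/`end` lines, qualified names of twinned
declarations), (ii) carrier-FREE declarations of the original (φ-level `Skelφ…` blocks and namespace-only arithmetic residents) are NOT re-declared —
this file imports the original and `export`s the twin-free residents (POLICY T / treatment (m1)); residents whose statement mentions a twinned
constant are copied, (iii) every carrier-binding declaration keeps its explicit binder `(Φ : PlanarSkeletonFrmFrom G)` in its own signature (r2).  Docstrings and citations are the original's.  Manifest row idx 39 (level 8; flags verbatim|DEF-ROW); filed by the hp-8 lineage under RULING M-11 (family P-hp8).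
-/

noncomputable section

open scoped Classical

namespace Summit.CriticalPhenomena.PercolationContinuityZ3.Theorems.Transplant

open MeasureTheory Literature.Probability.Percolation Literature.Probability.LatticeModels SimpleGraph KNCells
open Literature.Barriers.CriticalPhenomena (HasExponentialGrowth)

namespace PlanarSkeletonFrmFrom

open SkelConc (Consts)
open Skelφ.StepI (DataN DataNS OutNS)

namespace NegB

open Neg

section Acc

variable (κ : Consts) {V : Type} [DecidableEq V] [Countable V] {G : SimpleGraph V} [G.LocallyFinite] (Φ : PlanarSkeletonFrmFrom G)

/-- **THE STEP-I‴ ACCURACY OF THE N2 CHOICE FUNCTION OF RECORD: THE CUBE** `δI3 := δkit³ / 16` (J11/(R-33): the (S0) kit consumes routes at the cube of the kit accuracy;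
the `/16` keeps N1's slack for ≤ 16-fold unions). [this work] -/
def δI3 : ℝ := Neg.δkit κ Φ ^ 3 / 16

/-- `0 < δI3`. [folklore] -/
theorem δI3_pos : 0 < δI3 κ Φ := by
  unfold δI3; have := Neg.δkit_pos κ Φ; positivity

/-- `δI3 ≤ a³ / 16` whenever `δkit ≤ a`. [folklore] -/
theorem δI3_le_cube_div_of_le {a : ℝ} (ha : Neg.δkit κ Φ ≤ a) : δI3 κ Φ ≤ a ^ 3 / 16 := by
  unfold δI3
  have h := pow_le_pow_left₀ (Neg.δkit_pos κ Φ).le ha 3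
  linarith

/-- **`δI3 ≤ a³` whenever `δkit ≤ a`** — the consumers' pattern: Step-I‴ inputs `> 1 − δI3` serve every route clause at `1 − a³` for `a ∈ {κ.δr 0, κ.δ₂, κ.δ, …}` via
`Neg.δkit_le_δr / δkit_le_δ₂ / δkit_le_δ` and `inputs_mono`. [folklore] -/
theorem δI3_le_cube_of_le {a : ℝ} (ha : Neg.δkit κ Φ ≤ a) : δI3 κ Φ ≤ a ^ 3 := by
  have h := δI3_le_cube_div_of_le κ Φ ha
  have h0 : 0 ≤ a ^ 3 := pow_nonneg ((Neg.δkit_pos κ Φ).le.trans ha) 3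
  linarith

/-- `δI3 ≤ δI` (the cube is finer than N1's square since `δkit ≤ 1`): every square-threshold consumer still applies. [folklore] -/
theorem δI3_le_δI : δI3 κ Φ ≤ Neg.δI κ Φ := by
  rw [(Neg.δI_eq κ Φ).1]; unfold δI3
  have h0 := Neg.δkit_pos κ Φ
  have h1 := Neg.δkit_le_one κ Φ
  have h3 : Neg.δkit κ Φ ^ 3 ≤ Neg.δkit κ Φ ^ 2 := by nlinarith
  nlinarith

/-- `δI3 < 1`. [folklore] -/
theorem δI3_lt_one : δI3 κ Φ < 1 := (δI3_le_δI κ Φ).trans_lt (Neg.δI_lt_one κ Φ)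

/-- `δI3 ≤ 1`. [folklore] -/
theorem δI3_le_one : δI3 κ Φ ≤ 1 := (δI3_lt_one κ Φ).le

end Acc

section Values

variable (κ : Consts) {V : Type} [DecidableEq V] [Countable V] {G : SimpleGraph V} [G.LocallyFinite] (Φ : PlanarSkeletonFrmFrom G) (t : V) (p : unitInterval)
  (Pv : PSlot) (gv fv : Neg.FSlot) (Sv : SSlot) (cv : CSlot) (bv : BSlot) (hC : Φ.CylSubcritical p)

/-- **THE N2 CHOICES OF RECORD at `(κ, Φ, t, p)`, Step-I‴ accuracy at the cube**: `NegB.choiceAtQ` (p348247) with `δI := δI3` — `m₀`, `Sz`, `SMn`, `Γ = ΓQ`, `FD = FDQ`,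
`LD = LDQ` unchanged. [cite: KozmaNitzan2024, §4 Theorem 6 (pp. 25–31)] -/
def choiceAtQ3 : ChoiceNQ κ Φ t p hC :=
  { choiceAtQ κ Φ t p Pv gv fv Sv cv bv hC with
    δI := δI3 κ Φ
    δI_pos := δI3_pos κ Φ
    δI_lt_one := δI3_lt_one κ Φ }

/-- The Step-I‴ accuracy of the choices of record is `δI3` (by `rfl`). [folklore] -/
@[simp] theorem choiceAtQ3_δI : (choiceAtQ3 κ Φ t p Pv gv fv Sv cv bv hC).δI = δI3 κ Φ := rfl

/-- The least seed level is the landed one (by `rfl`). [folklore] -/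
@[simp] theorem choiceAtQ3_m₀ : (choiceAtQ3 κ Φ t p Pv gv fv Sv cv bv hC).m₀ = (choiceAtQ κ Φ t p Pv gv fv Sv cv bv hC).m₀ := rfl

/-- The zone sizes are the landed ones (by `rfl`). [folklore] -/
@[simp] theorem choiceAtQ3_Sz : (choiceAtQ3 κ Φ t p Pv gv fv Sv cv bv hC).Sz = (choiceAtQ κ Φ t p Pv gv fv Sv cv bv hC).Sz := rfl

/-- The admissible pairs are the landed ones (by `rfl`). [folklore] -/
@[simp] theorem choiceAtQ3_SMn : (choiceAtQ3 κ Φ t p Pv gv fv Sv cv bv hC).SMn = (choiceAtQ κ Φ t p Pv gv fv Sv cv bv hC).SMn := rfl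

/-- The anchored cells are `ΓQ` (by `rfl`). [folklore] -/
@[simp] theorem choiceAtQ3_Γ (O : OutNS V) (q : unitInterval) : (choiceAtQ3 κ Φ t p Pv gv fv Sv cv bv hC).Γ O q = ΓQ κ Φ t p O gv fv Sv cv bv q := rfl

/-- The face data are `FDQ` (by `rfl`). [folklore] -/
@[simp] theorem choiceAtQ3_FD (O : OutNS V) (q : unitInterval) : (choiceAtQ3 κ Φ t p Pv gv fv Sv cv bv hC).FD O q = FDQ κ Φ t p O gv fv Sv cv q := rfl

/-- The level data are `LDQ` (by `rfl`). [folklore] -/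
@[simp] theorem choiceAtQ3_LD (O : OutNS V) (q : unitInterval) : (choiceAtQ3 κ Φ t p Pv gv fv Sv cv bv hC).LD O q = LDQ κ Φ t p O gv fv cv := rfl

/-- The scheme of the choices of record at `(O, q)` is `⟨ΓQ, q, κ.δ⟩` (by `rfl`). [folklore] -/
theorem choiceAtQ3_scheme (O : OutNS V) (q : unitInterval) :
    (choiceAtQ3 κ Φ t p Pv gv fv Sv cv bv hC).scheme O q = ⟨ΓQ κ Φ t p O gv fv Sv cv bv q, q, κ.δ⟩ := rfl

end Values

end NegB

/-- **THE CHOICE FUNCTION OF RECORD OF THE FRAMES-ONLY NODE, six slots, Step-I‴ accuracy at the cube** (J11/(R-33); box `gv`, width `fv`, extra pairs `Pv`, fibre block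
`Sv`, creep `cv`, arrival box `bv`): the `ChoiceFnNQ` the four wrappers and the node₂ file meet. [cite: KozmaNitzan2024, §4 Theorem 6 (pp. 25–31)] -/
def frmChoiceAllQ3 (gv fv : Neg.FSlot) (Pv : NegB.PSlot) (Sv : NegB.SSlot) (cv : NegB.CSlot) (bv : NegB.BSlot) : ChoiceFnNQ :=
  fun κ _ _ _ _ _ Φ _ t _ _ p _ _ hC => NegB.choiceAtQ3 κ Φ t p Pv gv fv Sv cv bv hC

/-- `frmChoiceAllQ3` unfolds to `NegB.choiceAtQ3` (by `rfl`). [folklore] -/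
theorem frmChoiceAllQ3_eq (gv fv : Neg.FSlot) (Pv : NegB.PSlot) (Sv : NegB.SSlot) (cv : NegB.CSlot) (bv : NegB.BSlot) (κ : Consts) {V : Type} [DecidableEq V] [Countable V]
    (G : SimpleGraph V) [G.LocallyFinite] (Φ : PlanarSkeletonFrmFrom G) (hg : ¬ HasExponentialGrowth G) (t : V) (ht : t ∈ Φ.types) (h1 : Φ.types = {t})
    (p : unitInterval) (hp0 : 0 < (p : ℝ)) (hp1 : (p : ℝ) < 1) (hC : Φ.CylSubcritical p) :
    frmChoiceAllQ3 gv fv Pv Sv cv bv κ G Φ hg t ht h1 p hp0 hp1 hC = NegB.choiceAtQ3 κ Φ t p Pv gv fv Sv cv bv hC := rfl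

/-- The scheme of the choice function of record at `(O, q)` is `⟨ΓQ, q, κ.δ⟩` (by `rfl`) — the form the (R)/(F)/(C) wrappers read. [folklore] -/
theorem frmChoiceAllQ3_scheme (gv fv : Neg.FSlot) (Pv : NegB.PSlot) (Sv : NegB.SSlot) (cv : NegB.CSlot) (bv : NegB.BSlot) (κ : Consts) {V : Type} [DecidableEq V] [Countable V]
    (G : SimpleGraph V) [G.LocallyFinite] (Φ : PlanarSkeletonFrmFrom G) (hg : ¬ HasExponentialGrowth G) (t : V) (ht : t ∈ Φ.types) (h1 : Φ.types = {t})
    (p : unitInterval) (hp0 : 0 < (p : ℝ)) (hp1 : (p : ℝ) < 1) (hC : Φ.CylSubcritical p) (O : Skelφ.StepI.OutNS V) (q : unitInterval) :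
    (frmChoiceAllQ3 gv fv Pv Sv cv bv κ G Φ hg t ht h1 p hp0 hp1 hC).scheme O q = ⟨NegB.ΓQ κ Φ t p O gv fv Sv cv bv q, q, κ.δ⟩ := rfl

end PlanarSkeletonFrmFrom

end Summit.CriticalPhenomena.PercolationContinuityZ3.Theorems.Transplant

end
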